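import Summits.ResolutionOfSingularities.ResolutionOfSingularities.Theorems.PurelyInseparableDim4PureLeafUnitEven
import Summits.ResolutionOfSingularities.ResolutionOfSingularities.Theorems.PurelyInseparableDim4PureLeafUnitPthPower
import Summits.ResolutionOfSingularities.ResolutionOfSingularities.Theorems.PurelyInseparableDim4PureLeafUnitLeafWin
import Summits.ResolutionOfSingularities.ResolutionOfSingularities.Theorems.PurelyInseparableDim4PureLeafUnitInScopeCensus
import Summits.ResolutionOfSingularities.ResolutionOfSingularities.Theorems.PurelyInseparableDim4PureLeafUnitPlainOdd1
import Summits.ResolutionOfSingularities.ResolutionOfSingularities.Theorems.PurelyInseparableDim4PureLeafUnitPlainOdd3A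
import Summits.ResolutionOfSingularities.ResolutionOfSingularities.Theorems.PurelyInseparableDim4PureLeafUnitPlainOdd3B
import Summits.ResolutionOfSingularities.ResolutionOfSingularities.Theorems.PurelyInseparableDim4PureLeafUnitPlainOdd1B
import Summits.ResolutionOfSingularities.ResolutionOfSingularities.Theorems.PurelyInseparableDim4PureLeafUnitPlainOdd3D
import Summits.ResolutionOfSingularities.ResolutionOfSingularities.Theorems.PurelyInseparableDim4PureLeafUnitPlainOdd1C
import Summits.ResolutionOfSingularities.ResolutionOfSingularities.Theorems.PurelyInseparableDim4PureLeafUnitPlainOdd1D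
import Summits.ResolutionOfSingularities.ResolutionOfSingularities.Theorems.PurelyInseparableDim4PureLeafUnitPlainOdd1E
import HarnessLib
import HarnessLib.Audit.Tags

/-!
# Purely inseparable fourfolds — CAPSTONE of brick (δ), PLAIN column: 58 of the 81 unit leaves `x^a(1+x₀)`, `a ∈ {1,2,3}⁴`, are PLAIN-GAME A-WINS over `𝔽₂` ‖ K; the other 23 are in-scope A-wins whose plain game is OPEN
# (cell res-dim4-pi, D-0157 DOOR 2; CONFIGS (2,2) unit-leaf row, plain column) [OURS · counted 0 · census corollary]

Width seat `res-dim4-p-10` (g5).  The PLAIN game is the coordinate-centre game of OUR frame v4 over `𝔽₂` WITHOUT scope cut-off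
(`StateWins 2`: player A blows up any Hironaka-permissible coordinate centre `V(z, x_S)`, B answers with any `𝔽₂`-rational
equimultiple point of any chart; A wins when the origin is no longer 2-fold or a centre has no equimultiple reply).  One theorem
for the plain column of the unit census (memo `pub/res-dim4/res-dim4-p-10/UNIT-CLASS-TEXT.md` §8–§9): for the 58 exponent vectors of
`plainCensus58` and EVERY booking `(r, exc)`, `StateWins 2 ⟨x^a·(1+x₀), r, exc⟩`.  Sources, cited not restated:
* `a₀ = 2` (27 leaves): `PureLeafNF.stateWins_unitLeaf_even` (p702830); `a ∈ {1222, 3222}`: `PureLeafNF.stateWins_unitLeaf_odd_of_forall_even`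
  (p703461); `a = 1111`: generation 3's `UnitDivergence.unitLeafRow18` (`…PureLeafUnitLeafWin`);
* the 28 other leaves with `a₀` odd and another odd exponent: the kernel certificates `UnitLeafPlain.U<a>.stateWins_unitLeaf_<a>_all` of
  `…PureLeafUnitPlainOdd1` (g4, p718527: 1112 1121 1122 1211 1212 1221 1223 1232 1322, checker `winCertHB`) and of this seat's
  `…PureLeafUnitPlainOdd3A/3B/1B/3D/1C/1D/1E` (3122 3212 3221 · 3223 3232 3322 · 1123 1132 1213 1231 1312 1321 · 3111 3112 3121 3211 ·
  1233 · 1323 · 1332; F-keyed rows, checker `WinCertSound.winCertHBLFN` p722716).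
The complement `plainOpen23` (= the 23 leaves of g4's in-scope files `…PureLeafUnitInScope<a>`) is listed with the cover lemma
`mem_plainCensus58_or_mem_plainOpen23` against g4's `InScopeWinCert.unitCensus81` (p721457); for those the tree has the IN-SCOPE win
(`InScopeWinCert.inScopeStateWins_unitCensus`) and NO plain-game theorem either way: two engines and this seat's box searches
(degree ≤ 12, depth ≤ 9) find no A-win, B's located defence runs through the magic curve `x_j + x_k + x_j x_k` out of coordinate
scope (`…PureLeafUnitMagicBlind` p706625), and no finite trap is known — whether any of the 23 is a plain-game B-win is OPEN.
Corollary `inScopeStateWins_plainCensus58`: the plain wins re-prove the in-scope entries of the 58.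

Riders: `𝔽₂`-rational replies only (NOT ∀K — nothing ascends from `𝔽₂` to `𝔽₄`); the plain coordinate game of OUR frame v4, not
MODE 1h and not CJS's algorithm; nothing here proves F4-C(2,2), `Terminates1h 2 2` or resolution of singularities in dimension ≥ 4 /
characteristic `p`; counted 0; AI kernel work, weaker than expert review. bears_on: LADDER-RESOLUTION:D157-DOOR2 (res-dim4-pi · brick (δ) ·
unit census, plain column). Supports stmt-ResolutionOfSingularities-16155 (helper).
-/

set_option linter.dupNamespace false

open MvPolynomial

noncomputable section

namespace Summit.ResolutionOfSingularities.ResolutionOfSingularities.Theorems.PIDim4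

namespace UnitLeafPlain

open Literature.AlgebraicGeometry.Resolution
open StepKit

/-- From a term-form plain certificate (every booking) to the monomial form `x^v·(1+x₀)`. [folklore] -/
theorem of_plainCert {v w : Fin 4 → ℕ} (hw : w = v + Pi.single 0 1)
    (h : ∀ (r : Fin 4 →₀ ℕ) (exc : Finset (Fin 4)), StateWins 2 (⟨evalT [(v, 1), (w, 1)], r, exc⟩ : State (ZMod 2)))
    (r : Fin 4 →₀ ℕ) (exc : Finset (Fin 4)) :
    StateWins 2 (⟨monomial (expo v) 1 * (1 + X 0), r, exc⟩ : State (ZMod 2)) :=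
  FlatAbsorb.stateWins_congr (h r exc) _ (InScopeWinCert.monomial_mul_one_add_X_eq_evalT v w hw)

/-- The 58 exponent vectors `a ∈ {1,2,3}⁴` whose unit leaf `x^a(1+x₀)` is a PLAIN-game A-win in the tree (lexicographic). [folklore] -/
def plainCensus58 : List (Fin 4 → ℕ) := [
  ![1, 1, 1, 1], ![1, 1, 1, 2], ![1, 1, 2, 1], ![1, 1, 2, 2], ![1, 1, 2, 3], ![1, 1, 3, 2],
  ![1, 2, 1, 1], ![1, 2, 1, 2], ![1, 2, 1, 3], ![1, 2, 2, 1], ![1, 2, 2, 2], ![1, 2, 2, 3],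
  ![1, 2, 3, 1], ![1, 2, 3, 2], ![1, 2, 3, 3], ![1, 3, 1, 2], ![1, 3, 2, 1], ![1, 3, 2, 2],
  ![1, 3, 2, 3], ![1, 3, 3, 2], ![2, 1, 1, 1], ![2, 1, 1, 2], ![2, 1, 1, 3], ![2, 1, 2, 1],
  ![2, 1, 2, 2], ![2, 1, 2, 3], ![2, 1, 3, 1], ![2, 1, 3, 2], ![2, 1, 3, 3], ![2, 2, 1, 1],
  ![2, 2, 1, 2], ![2, 2, 1, 3], ![2, 2, 2, 1], ![2, 2, 2, 2], ![2, 2, 2, 3], ![2, 2, 3, 1],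
  ![2, 2, 3, 2], ![2, 2, 3, 3], ![2, 3, 1, 1], ![2, 3, 1, 2], ![2, 3, 1, 3], ![2, 3, 2, 1],
  ![2, 3, 2, 2], ![2, 3, 2, 3], ![2, 3, 3, 1], ![2, 3, 3, 2], ![2, 3, 3, 3], ![3, 1, 1, 1],
  ![3, 1, 1, 2], ![3, 1, 2, 1], ![3, 1, 2, 2], ![3, 2, 1, 1], ![3, 2, 1, 2], ![3, 2, 2, 1],
  ![3, 2, 2, 2], ![3, 2, 2, 3], ![3, 2, 3, 2], ![3, 3, 2, 2] ]

/-- The 23 exponent vectors whose unit leaf is in-scope escapable ‖ K but whose PLAIN game is undecided in the tree. [folklore] -/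
def plainOpen23 : List (Fin 4 → ℕ) := [
  ![1, 1, 1, 3], ![1, 1, 3, 1], ![1, 1, 3, 3], ![1, 3, 1, 1], ![1, 3, 1, 3], ![1, 3, 3, 1],
  ![1, 3, 3, 3], ![3, 1, 1, 3], ![3, 1, 2, 3], ![3, 1, 3, 1], ![3, 1, 3, 2], ![3, 1, 3, 3],
  ![3, 2, 1, 3], ![3, 2, 3, 1], ![3, 2, 3, 3], ![3, 3, 1, 1], ![3, 3, 1, 2], ![3, 3, 1, 3],
  ![3, 3, 2, 1], ![3, 3, 2, 3], ![3, 3, 3, 1], ![3, 3, 3, 2], ![3, 3, 3, 3] ]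

/-- The two lists cover g4's census list `unitCensus81`. [folklore] -/
theorem mem_plainCensus58_or_mem_plainOpen23 : ∀ v ∈ InScopeWinCert.unitCensus81, v ∈ plainCensus58 ∨ v ∈ plainOpen23 := by
  decide

/-- … and are drawn from it. [folklore] -/
theorem plainCensus58_append_subset : ∀ v ∈ plainCensus58 ++ plainOpen23, v ∈ InScopeWinCert.unitCensus81 := by
  decide

/-- **CAPSTONE (plain column): 58 unit leaves of the census are PLAIN-game A-wins over `𝔽₂`, every booking.** [OURS · counted 0 · ‖ K]
[folklore] -/
theorem stateWins_plainCensus58 : ∀ v ∈ plainCensus58, ∀ (r : Fin 4 →₀ ℕ) (exc : Finset (Fin 4)),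
    StateWins 2 (⟨monomial (expo v) 1 * (1 + X 0), r, exc⟩ : State (ZMod 2)) := by
  unfold plainCensus58
  refine List.forall_mem_cons.mpr ⟨fun r exc => ?_, ?_⟩ -- 1111
  · exact of_plainCert (by decide) UnitDivergence.unitLeafRow18 r exc
  refine List.forall_mem_cons.mpr ⟨fun r exc => ?_, ?_⟩ -- 1112 (`…PureLeafUnitPlainOdd1`)
  · exact of_plainCert (by decide) U1112.stateWins_unitLeaf_1112_all r exc
  refine List.forall_mem_cons.mpr ⟨fun r exc => ?_, ?_⟩ -- 1121 (`…PureLeafUnitPlainOdd1`)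
  · exact of_plainCert (by decide) U1121.stateWins_unitLeaf_1121_all r exc
  refine List.forall_mem_cons.mpr ⟨fun r exc => ?_, ?_⟩ -- 1122 (`…PureLeafUnitPlainOdd1`)
  · exact of_plainCert (by decide) U1122.stateWins_unitLeaf_1122_all r exc
  refine List.forall_mem_cons.mpr ⟨fun r exc => ?_, ?_⟩ -- 1123 (`…PureLeafUnitPlainOdd1B`)
  · exact of_plainCert (by decide) U1123.stateWins_unitLeaf_1123_all r exc
  refine List.forall_mem_cons.mpr ⟨fun r exc => ?_, ?_⟩ -- 1132 (`…PureLeafUnitPlainOdd1B`)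
  · exact of_plainCert (by decide) U1132.stateWins_unitLeaf_1132_all r exc
  refine List.forall_mem_cons.mpr ⟨fun r exc => ?_, ?_⟩ -- 1211 (`…PureLeafUnitPlainOdd1`)
  · exact of_plainCert (by decide) U1211.stateWins_unitLeaf_1211_all r exc
  refine List.forall_mem_cons.mpr ⟨fun r exc => ?_, ?_⟩ -- 1212 (`…PureLeafUnitPlainOdd1`)
  · exact of_plainCert (by decide) U1212.stateWins_unitLeaf_1212_all r exc
  refine List.forall_mem_cons.mpr ⟨fun r exc => ?_, ?_⟩ -- 1213 (`…PureLeafUnitPlainOdd1B`)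
  · exact of_plainCert (by decide) U1213.stateWins_unitLeaf_1213_all r exc
  refine List.forall_mem_cons.mpr ⟨fun r exc => ?_, ?_⟩ -- 1221 (`…PureLeafUnitPlainOdd1`)
  · exact of_plainCert (by decide) U1221.stateWins_unitLeaf_1221_all r exc
  refine List.forall_mem_cons.mpr ⟨fun r exc => ?_, ?_⟩ -- 1222
  · exact PureLeafNF.stateWins_unitLeaf_odd_of_forall_even 0 ![1, 2, 2, 2] (by decide) (by decide) r exc
  refine List.forall_mem_cons.mpr ⟨fun r exc => ?_, ?_⟩ -- 1223 (`…PureLeafUnitPlainOdd1`)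
  · exact of_plainCert (by decide) U1223.stateWins_unitLeaf_1223_all r exc
  refine List.forall_mem_cons.mpr ⟨fun r exc => ?_, ?_⟩ -- 1231 (`…PureLeafUnitPlainOdd1B`)
  · exact of_plainCert (by decide) U1231.stateWins_unitLeaf_1231_all r exc
  refine List.forall_mem_cons.mpr ⟨fun r exc => ?_, ?_⟩ -- 1232 (`…PureLeafUnitPlainOdd1`)
  · exact of_plainCert (by decide) U1232.stateWins_unitLeaf_1232_all r exc
  refine List.forall_mem_cons.mpr ⟨fun r exc => ?_, ?_⟩ -- 1233 (`…PureLeafUnitPlainOdd1C`)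
  · exact of_plainCert (by decide) U1233.stateWins_unitLeaf_1233_all r exc
  refine List.forall_mem_cons.mpr ⟨fun r exc => ?_, ?_⟩ -- 1312 (`…PureLeafUnitPlainOdd1B`)
  · exact of_plainCert (by decide) U1312.stateWins_unitLeaf_1312_all r exc
  refine List.forall_mem_cons.mpr ⟨fun r exc => ?_, ?_⟩ -- 1321 (`…PureLeafUnitPlainOdd1B`)
  · exact of_plainCert (by decide) U1321.stateWins_unitLeaf_1321_all r exc
  refine List.forall_mem_cons.mpr ⟨fun r exc => ?_, ?_⟩ -- 1322 (`…PureLeafUnitPlainOdd1`)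
  · exact of_plainCert (by decide) U1322.stateWins_unitLeaf_1322_all r exc
  refine List.forall_mem_cons.mpr ⟨fun r exc => ?_, ?_⟩ -- 1323 (`…PureLeafUnitPlainOdd1D`)
  · exact of_plainCert (by decide) U1323.stateWins_unitLeaf_1323_all r exc
  refine List.forall_mem_cons.mpr ⟨fun r exc => ?_, ?_⟩ -- 1332 (`…PureLeafUnitPlainOdd1E`)
  · exact of_plainCert (by decide) U1332.stateWins_unitLeaf_1332_all r exc
  refine List.forall_mem_cons.mpr ⟨fun r exc => ?_, ?_⟩ -- 2111
  · exact PureLeafNF.stateWins_unitLeaf_even 0 ![2, 1, 1, 1] (by decide) r exc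
  refine List.forall_mem_cons.mpr ⟨fun r exc => ?_, ?_⟩ -- 2112
  · exact PureLeafNF.stateWins_unitLeaf_even 0 ![2, 1, 1, 2] (by decide) r exc
  refine List.forall_mem_cons.mpr ⟨fun r exc => ?_, ?_⟩ -- 2113
  · exact PureLeafNF.stateWins_unitLeaf_even 0 ![2, 1, 1, 3] (by decide) r exc
  refine List.forall_mem_cons.mpr ⟨fun r exc => ?_, ?_⟩ -- 2121
  · exact PureLeafNF.stateWins_unitLeaf_even 0 ![2, 1, 2, 1] (by decide) r exc
  refine List.forall_mem_cons.mpr ⟨fun r exc => ?_, ?_⟩ -- 2122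
  · exact PureLeafNF.stateWins_unitLeaf_even 0 ![2, 1, 2, 2] (by decide) r exc
  refine List.forall_mem_cons.mpr ⟨fun r exc => ?_, ?_⟩ -- 2123
  · exact PureLeafNF.stateWins_unitLeaf_even 0 ![2, 1, 2, 3] (by decide) r exc
  refine List.forall_mem_cons.mpr ⟨fun r exc => ?_, ?_⟩ -- 2131
  · exact PureLeafNF.stateWins_unitLeaf_even 0 ![2, 1, 3, 1] (by decide) r exc
  refine List.forall_mem_cons.mpr ⟨fun r exc => ?_, ?_⟩ -- 2132
  · exact PureLeafNF.stateWins_unitLeaf_even 0 ![2, 1, 3, 2] (by decide) r exc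
  refine List.forall_mem_cons.mpr ⟨fun r exc => ?_, ?_⟩ -- 2133
  · exact PureLeafNF.stateWins_unitLeaf_even 0 ![2, 1, 3, 3] (by decide) r exc
  refine List.forall_mem_cons.mpr ⟨fun r exc => ?_, ?_⟩ -- 2211
  · exact PureLeafNF.stateWins_unitLeaf_even 0 ![2, 2, 1, 1] (by decide) r exc
  refine List.forall_mem_cons.mpr ⟨fun r exc => ?_, ?_⟩ -- 2212
  · exact PureLeafNF.stateWins_unitLeaf_even 0 ![2, 2, 1, 2] (by decide) r exc
  refine List.forall_mem_cons.mpr ⟨fun r exc => ?_, ?_⟩ -- 2213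
  · exact PureLeafNF.stateWins_unitLeaf_even 0 ![2, 2, 1, 3] (by decide) r exc
  refine List.forall_mem_cons.mpr ⟨fun r exc => ?_, ?_⟩ -- 2221
  · exact PureLeafNF.stateWins_unitLeaf_even 0 ![2, 2, 2, 1] (by decide) r exc
  refine List.forall_mem_cons.mpr ⟨fun r exc => ?_, ?_⟩ -- 2222
  · exact PureLeafNF.stateWins_unitLeaf_even 0 ![2, 2, 2, 2] (by decide) r exc
  refine List.forall_mem_cons.mpr ⟨fun r exc => ?_, ?_⟩ -- 2223
  · exact PureLeafNF.stateWins_unitLeaf_even 0 ![2, 2, 2, 3] (by decide) r exc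
  refine List.forall_mem_cons.mpr ⟨fun r exc => ?_, ?_⟩ -- 2231
  · exact PureLeafNF.stateWins_unitLeaf_even 0 ![2, 2, 3, 1] (by decide) r exc
  refine List.forall_mem_cons.mpr ⟨fun r exc => ?_, ?_⟩ -- 2232
  · exact PureLeafNF.stateWins_unitLeaf_even 0 ![2, 2, 3, 2] (by decide) r exc
  refine List.forall_mem_cons.mpr ⟨fun r exc => ?_, ?_⟩ -- 2233
  · exact PureLeafNF.stateWins_unitLeaf_even 0 ![2, 2, 3, 3] (by decide) r exc
  refine List.forall_mem_cons.mpr ⟨fun r exc => ?_, ?_⟩ -- 2311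
  · exact PureLeafNF.stateWins_unitLeaf_even 0 ![2, 3, 1, 1] (by decide) r exc
  refine List.forall_mem_cons.mpr ⟨fun r exc => ?_, ?_⟩ -- 2312
  · exact PureLeafNF.stateWins_unitLeaf_even 0 ![2, 3, 1, 2] (by decide) r exc
  refine List.forall_mem_cons.mpr ⟨fun r exc => ?_, ?_⟩ -- 2313
  · exact PureLeafNF.stateWins_unitLeaf_even 0 ![2, 3, 1, 3] (by decide) r exc
  refine List.forall_mem_cons.mpr ⟨fun r exc => ?_, ?_⟩ -- 2321
  · exact PureLeafNF.stateWins_unitLeaf_even 0 ![2, 3, 2, 1] (by decide) r exc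
  refine List.forall_mem_cons.mpr ⟨fun r exc => ?_, ?_⟩ -- 2322
  · exact PureLeafNF.stateWins_unitLeaf_even 0 ![2, 3, 2, 2] (by decide) r exc
  refine List.forall_mem_cons.mpr ⟨fun r exc => ?_, ?_⟩ -- 2323
  · exact PureLeafNF.stateWins_unitLeaf_even 0 ![2, 3, 2, 3] (by decide) r exc
  refine List.forall_mem_cons.mpr ⟨fun r exc => ?_, ?_⟩ -- 2331
  · exact PureLeafNF.stateWins_unitLeaf_even 0 ![2, 3, 3, 1] (by decide) r exc
  refine List.forall_mem_cons.mpr ⟨fun r exc => ?_, ?_⟩ -- 2332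
  · exact PureLeafNF.stateWins_unitLeaf_even 0 ![2, 3, 3, 2] (by decide) r exc
  refine List.forall_mem_cons.mpr ⟨fun r exc => ?_, ?_⟩ -- 2333
  · exact PureLeafNF.stateWins_unitLeaf_even 0 ![2, 3, 3, 3] (by decide) r exc
  refine List.forall_mem_cons.mpr ⟨fun r exc => ?_, ?_⟩ -- 3111 (`…PureLeafUnitPlainOdd3D`)
  · exact of_plainCert (by decide) U3111.stateWins_unitLeaf_3111_all r exc
  refine List.forall_mem_cons.mpr ⟨fun r exc => ?_, ?_⟩ -- 3112 (`…PureLeafUnitPlainOdd3D`)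
  · exact of_plainCert (by decide) U3112.stateWins_unitLeaf_3112_all r exc
  refine List.forall_mem_cons.mpr ⟨fun r exc => ?_, ?_⟩ -- 3121 (`…PureLeafUnitPlainOdd3D`)
  · exact of_plainCert (by decide) U3121.stateWins_unitLeaf_3121_all r exc
  refine List.forall_mem_cons.mpr ⟨fun r exc => ?_, ?_⟩ -- 3122 (`…PureLeafUnitPlainOdd3A`)
  · exact of_plainCert (by decide) U3122.stateWins_unitLeaf_3122_all r exc
  refine List.forall_mem_cons.mpr ⟨fun r exc => ?_, ?_⟩ -- 3211 (`…PureLeafUnitPlainOdd3D`)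
  · exact of_plainCert (by decide) U3211.stateWins_unitLeaf_3211_all r exc
  refine List.forall_mem_cons.mpr ⟨fun r exc => ?_, ?_⟩ -- 3212 (`…PureLeafUnitPlainOdd3A`)
  · exact of_plainCert (by decide) U3212.stateWins_unitLeaf_3212_all r exc
  refine List.forall_mem_cons.mpr ⟨fun r exc => ?_, ?_⟩ -- 3221 (`…PureLeafUnitPlainOdd3A`)
  · exact of_plainCert (by decide) U3221.stateWins_unitLeaf_3221_all r exc
  refine List.forall_mem_cons.mpr ⟨fun r exc => ?_, ?_⟩ -- 3222
  · exact PureLeafNF.stateWins_unitLeaf_odd_of_forall_even 0 ![3, 2, 2, 2] (by decide) (by decide) r exc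
  refine List.forall_mem_cons.mpr ⟨fun r exc => ?_, ?_⟩ -- 3223 (`…PureLeafUnitPlainOdd3B`)
  · exact of_plainCert (by decide) U3223.stateWins_unitLeaf_3223_all r exc
  refine List.forall_mem_cons.mpr ⟨fun r exc => ?_, ?_⟩ -- 3232 (`…PureLeafUnitPlainOdd3B`)
  · exact of_plainCert (by decide) U3232.stateWins_unitLeaf_3232_all r exc
  refine List.forall_mem_cons.mpr ⟨fun r exc => ?_, ?_⟩ -- 3322 (`…PureLeafUnitPlainOdd3B`)
  · exact of_plainCert (by decide) U3322.stateWins_unitLeaf_3322_all r exc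
  exact List.forall_mem_nil _

/-- Hypothesis form. [folklore] -/
theorem stateWins_unitLeaf_of_mem_plainCensus58 (v : Fin 4 → ℕ) (hv : v ∈ plainCensus58) (r : Fin 4 →₀ ℕ) (exc : Finset (Fin 4)) :
    StateWins 2 (⟨monomial (expo v) 1 * (1 + X 0), r, exc⟩ : State (ZMod 2)) :=
  stateWins_plainCensus58 v hv r exc

/-- Corollary: the plain wins re-prove the in-scope entries of the 58 (g4's `inScopeStateWins_unitCensus` covers all 81). [folklore] -/
theorem inScopeStateWins_plainCensus58 (v : Fin 4 → ℕ) (hv : v ∈ plainCensus58) (r : Fin 4 →₀ ℕ) (exc : Finset (Fin 4)) :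
    InScopeWinCert.InScopeStateWins 2 (⟨monomial (expo v) 1 * (1 + X 0), r, exc⟩ : State (ZMod 2)) :=
  InScopeWinCert.inScopeStateWins_of_stateWins (stateWins_plainCensus58 v hv r exc)

end UnitLeafPlain

end Summit.ResolutionOfSingularities.ResolutionOfSingularities.Theorems.PIDim4

end
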